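import Summits.QuantumFields.YangMills.Theorems.UnitScaleTiltFluctuationComparisonRegPrLiftLegsKernel

/-!
# Route `UnitScaleTilt` — crux K1bR-pr `FluctuationComparisonRegPr` (stmt-QuantumFields-19201 → `…L`), stub `stub_oneStepSmallLift`, piece (L2):
# the Γ-LEG LAYER, consistency check — A FACE-SUPPORTED S-NEUTRAL TABLE IS LINE-NEUTRAL (support file `--supports stmt-QuantumFields-19201`)

Cell `ym3-torus` (HUMAN RULING D-0037, YM ladder rung R3), seat `ym3-torus-p1` gen 11 (UV side).  The fleet's accuracy hypothesis for a kernel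
table is `FaceSupported ∧ SNeutral` (`…LiftFaceKernel`); the Γ-leg layer's is `LineNeutral` (`…LiftLegsKernel`: the LINE FORM `lineIn + lineOut`
vanishes).  This file proves the former implies the latter — so `exists_approxSmallLift_of_kernel_lineNeutral` (file 6) COVERS the face-supported
certificates (CertL3Face, CertL5, ANSATZ S) as well as interior-supported ones, and the in∕out∕shift bookkeeping of the line form is checked
against the fleet's conventions:

* `lineOut_eq_zero_of_faceSupported`: the far bonds of a row sit at offsets `t < r_a ≤ L − 1` in their direction, where a face-supported table
  vanishes;
* `lineIn_eq_faceSum_of_faceSupported`: only the exit bond `t = L − 1 − r_a` of each row survives, so `lineIn = L^{-d} Σ_{o,k} (Σ_r kz(a, r[a ↦ L−1], o, k)) • w(o,k−R)`;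
* **`lineNeutral_of_faceSupported_sNeutral`**.

Elementary; nothing of Bałaban's is asserted.
-/

noncomputable section

open scoped BigOperators

namespace Summit.QuantumFields.YangMills.Theorems.ApproxLift

open Literature.MathematicalPhysics.QuantumFieldTheory.Balaban1983to89
open T4Continuum BlockAveraging AveragingRT B10Eq47AxialChi BlockAveragingSection BlockAveragingSectionPlaq

variable {P : Params} {j : ℕ} {n : Type*}
variable {R : ℕ} {kz : Fin P.d → (Fin P.d → Fin P.L) → Orient P.d → (Fin P.d → Fin (2 * R + 1)) → ℝ}

/-- For a face-supported table the OUT-LINE FORM vanishes: `(outOff r a t)_a = t < r_a ≤ L − 1`. -/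
theorem lineOut_eq_zero_of_faceSupported (hF : FaceSupported R kz) (a : Fin P.d) (w : Orient P.d → (Fin P.d → ℤ) → Matrix n n ℂ) :
    lineOut (n := n) R kz a w = 0 := by
  unfold lineOut
  rw [Finset.sum_eq_zero fun r _ => ?_, smul_zero]
  refine Finset.sum_eq_zero fun t _ => Finset.sum_eq_zero fun o _ => Finset.sum_eq_zero fun k _ => ?_
  have hne : ((outOff r a t) a : ℕ) ≠ P.L - 1 := by
    unfold outOff
    rw [Function.update_self]
    have := t.isLt; have := (r a).isLt
    simp only [ne_eq]
    omega
  rw [hF a _ o k hne, Complex.ofReal_zero, zero_smul]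

/-- For a face-supported table only the EXIT bond of each row contributes to the IN-LINE FORM:
`lineIn = L^{-d} Σ_r Σ_{o,k} kz(a, r[a ↦ L−1], o, k) • w(o, k − R)`. -/
theorem lineIn_eq_faceSum_of_faceSupported (hF : FaceSupported R kz) (a : Fin P.d) (w : Orient P.d → (Fin P.d → ℤ) → Matrix n n ℂ) :
    lineIn (n := n) R kz a w = (((P.L : ℂ) ^ P.d))⁻¹ • ∑ r : Fin P.d → Fin P.L,
      ∑ o : Orient P.d, ∑ k : Fin P.d → Fin (2 * R + 1), ((kz a (Function.update r a (lastPos P)) o k : ℝ) : ℂ) • w o (kvec R k) := by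
  unfold lineIn
  congr 1
  refine Finset.sum_congr rfl fun r _ => ?_
  have hr := (r a).isLt
  -- the exit index `t⋆ = L − 1 − r_a`
  have ht : P.L - 1 - (r a : ℕ) < P.L - (r a : ℕ) := by omega
  rw [Finset.sum_eq_single ⟨P.L - 1 - (r a : ℕ), ht⟩]
  · congr 1
    funext o
    congr 1
    funext k
    congr 3
    unfold inOff lastPos
    congr 1
    apply Fin.ext
    simp only
    omega
  · intro t _ hne
    refine Finset.sum_eq_zero fun o _ => Finset.sum_eq_zero fun k _ => ?_
    have hne' : ((inOff r a t) a : ℕ) ≠ P.L - 1 := by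
      unfold inOff
      rw [Function.update_self]
      intro h
      apply hne
      apply Fin.ext
      simp only at h ⊢
      omega
    rw [hF a _ o k hne', Complex.ofReal_zero, zero_smul]
  · intro h; exact absurd (Finset.mem_univ _) h

/-- **A FACE-SUPPORTED, S-NEUTRAL TABLE IS LINE-NEUTRAL**: the Γ-leg layer's accuracy hypothesis generalises the fleet's. -/
theorem lineNeutral_of_faceSupported_sNeutral (hF : FaceSupported R kz) (hS : SNeutral R kz) : LineNeutral (n := n) R kz := by
  intro a w
  rw [lineOut_eq_zero_of_faceSupported hF, add_zero, lineIn_eq_faceSum_of_faceSupported hF]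
  rw [Finset.sum_comm]
  have h0 : ∑ o : Orient P.d, ∑ r : Fin P.d → Fin P.L, ∑ k : Fin P.d → Fin (2 * R + 1),
      ((kz a (Function.update r a (lastPos P)) o k : ℝ) : ℂ) • w o (kvec R k) = 0 := by
    refine Finset.sum_eq_zero fun o _ => ?_
    rw [Finset.sum_comm]
    refine Finset.sum_eq_zero fun k _ => ?_
    rw [← Finset.sum_smul, ← Complex.ofReal_sum, hS a o k, Complex.ofReal_zero, zero_smul]
  rw [h0, smul_zero]

end Summit.QuantumFields.YangMills.Theorems.ApproxLift

end
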